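import Summits.CriticalPhenomena.PercolationContinuityZ3.Theorems.PercNearOneGluingNoHeavyLowerTailSahiCTCRtThreeCorners
import HarnessLib

/-!
# `NoHeavyLowerTail` (crux stmt-CriticalPhenomena-4575), P3 lane: ROW 0 of `R_3 ∈ ℕ[s]` FROM A SEPARABLE CERTIFICATE
# (memo g49 §3; fourth of four proof files; definitions in `…RtThreeSepDefs`)

Support file (seat `prim-l12-p3`, gen 49; `--supports stmt-CriticalPhenomena-4575`).  Memo
`run/shared/lean/prim/prim-l12/FROM-prim-l12-p3-g49-SEPARABLE-CERTIFICATES.md` §3.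

* `Mrow_eq_Mtype` : the matrix `M_V(S,S')` of the squarefree row depends only on the type `(a,b,c)` of `(S,S')` and on
  `o = #(V ∖ (S ∪ S'))` (`card_filter_card_le_two` : `#{U ⊆ W : #U ≤ 2} = θ₂(#W)`);
* **`coeff_ind_Rt_three_nonneg_of_sepCert`** : for a loop-free pair of up-sets on `V` (`∅` and the singletons of `V` are non-members):
  if five nonnegative weight tables satisfy `sepE = Mtype` on every type `(a,b,c,o)` with `a+b+c+o = #V`, `2 ≤ a+b`, `2 ≤ a+c`, then
  `[s^V] R_3(𝒳,𝒵) ≥ 0` (the types with `a+b ≤ 1` or `a+c ≤ 1` carry `[S ∈ 𝒳][S' ∈ 𝒵] = 0` by loop-freeness);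
* `tab_nonneg`, `sepCert_of_fin` : the two hypotheses in the decidable form used by the certificate files.
Exact rational weight tables exist for `#V ≤ 9` (kit jobs j302229, j303354) and do not exist for `#V = 10, 11` (all five single-step tables,
HiGHS; memo §3.4): the certificates are a finite-size device.  The tables for `#V = 8` follow in `…RtThreeCertEight`.
Nothing is asserted about the crux.
-/

noncomputable section

open scoped Classical

namespace Summit.CriticalPhenomena.PercolationContinuityZ3.Theorems.SahiCTCForms

open Finset MvPolynomial SahiCTCGenFun

variable {α : Type*} [DecidableEq α] [Fintype α]

/-! ### The certificate theorem -/

section Cert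
variable (wJ wX wOx wOz wOO : ℕ → ℕ → ℕ → ℚ)

omit [Fintype α] in
/-- `#{U ⊆ W : #U ≤ 2} = θ₂(#W)`. [this work] -/
theorem card_filter_card_le_two (W : Finset α) : #(W.powerset.filter fun U => #U ≤ 2) = theta2 #W := by
  have hsplit : (W.powerset.filter fun U => #U ≤ 2) = powersetCard 0 W ∪ powersetCard 1 W ∪ powersetCard 2 W := by
    ext U; simp only [mem_filter, mem_powerset, mem_union, mem_powersetCard]
    by_cases hUW : U ⊆ W
    · simp only [hUW, true_and]; omega
    · simp [hUW]
  have hd01 : Disjoint (powersetCard 0 W) (powersetCard 1 W) :=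
    disjoint_left.2 fun U h0 h1 => by rw [mem_powersetCard] at h0 h1; omega
  have hd2 : Disjoint (powersetCard 0 W ∪ powersetCard 1 W) (powersetCard 2 W) :=
    disjoint_left.2 fun U h01 h2 => by
      rw [mem_union, mem_powersetCard, mem_powersetCard] at h01; rw [mem_powersetCard] at h2; omega
  rw [hsplit, card_union_of_disjoint hd2, card_union_of_disjoint hd01, card_powersetCard, card_powersetCard, card_powersetCard]
  unfold theta2; simp

omit [Fintype α] in
/-- `Mrow` depends only on the type. [this work] -/
theorem Mrow_eq_Mtype (V S S' : Finset α) :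
    (Mrow V S S' : ℚ) = Mtype #(S ∩ S') #(S \ S') #(S' \ S) #(V \ (S ∪ S')) := by
  have hab : #(S ∩ S') + #(S \ S') = #S := card_inter_add_card_sdiff S S'
  have hac : #(S ∩ S') + #(S' \ S) = #S' := by rw [inter_comm]; exact card_inter_add_card_sdiff S' S
  have heq : S = S' ↔ #(S \ S') = 0 ∧ #(S' \ S) = 0 := by
    rw [card_eq_zero, card_eq_zero, sdiff_eq_empty_iff_subset, sdiff_eq_empty_iff_subset]
    exact ⟨fun h => ⟨h.le, h.ge⟩, fun h => Subset.antisymm h.1 h.2⟩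
  have hdis : Disjoint S S' ↔ #(S ∩ S') = 0 := by rw [card_eq_zero, disjoint_iff_inter_eq_empty]
  unfold Mrow Mtype
  push_cast
  have e1 : (if S = S' ∧ 3 ≤ #S then ((#((V \ S).powerset.filter fun U => #U ≤ 2) : ℕ) : ℚ) else 0)
      = if #(S \ S') = 0 ∧ #(S' \ S) = 0 ∧ 3 ≤ #(S ∩ S') then (theta2 #(V \ (S ∪ S')) : ℚ) else 0 := by
    by_cases h : S = S' ∧ 3 ≤ #S
    · obtain ⟨h1, h2⟩ := h
      have h3 := heq.1 h1
      subst h1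
      rw [if_pos ⟨rfl, h2⟩, if_pos ⟨h3.1, h3.2, by rw [inter_self]; exact h2⟩, card_filter_card_le_two, union_self]
    · rw [if_neg h, if_neg]
      rintro ⟨hb, hc, ha⟩
      have h1 : S = S' := heq.2 ⟨hb, hc⟩
      exact h ⟨h1, by rw [← hab, hb, add_zero]; exact ha⟩
  have e2 : (if Disjoint S S' ∧ #(V \ (S ∪ S')) ≤ 2 then (1:ℚ) else 0) = if #(S ∩ S') = 0 ∧ #(V \ (S ∪ S')) ≤ 2 then 1 else 0 :=
    if_congr (by rw [hdis]) rfl rfl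
  have e3 : (if Disjoint S S' ∧ #S < 3 ∧ #S' < 3 then (1:ℚ) else 0)
      = if #(S ∩ S') = 0 ∧ #(S ∩ S') + #(S \ S') < 3 ∧ #(S ∩ S') + #(S' \ S) < 3 then 1 else 0 :=
    if_congr (by rw [hdis, hab, hac]) rfl rfl
  rw [e1, e2, e3]

omit [Fintype α] in
/-- The two indicators agree after the cast `ℤ → ℚ`. [this work] -/
theorem ι_cast (F : Finset (Finset α)) (S : Finset α) : ((ι F S : ℤ) : ℚ) = ιq F S := by
  unfold ι ιq; split_ifs <;> simp

/-- **ROW 0 FROM A SEPARABLE CERTIFICATE.**  For a loop-free pair of up-sets on `V` (`∅` and the singletons of `V` are non-members): if five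
nonnegative weight tables satisfy `sepE = M` on every type `(a,b,c,o)` with `a+b+c+o = #V`, `a+b ≥ 2`, `a+c ≥ 2`, then `[s^V] R_3(𝒳,𝒵) ≥ 0`. [this work] -/
theorem coeff_ind_Rt_three_nonneg_of_sepCert {F G : Finset (Finset α)} (hF : IsUpperSet (F : Set (Finset α)))
    (hG : IsUpperSet (G : Set (Finset α))) (V : Finset α)
    (h0F : ∅ ∉ F) (h0G : ∅ ∉ G) (h1F : ∀ v ∈ V, ({v} : Finset α) ∉ F) (h1G : ∀ v ∈ V, ({v} : Finset α) ∉ G)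
    (hJ : ∀ a b c, 0 ≤ wJ a b c) (hX : ∀ a b c, 0 ≤ wX a b c) (hOx : ∀ a b c, 0 ≤ wOx a b c)
    (hOz : ∀ a b c, 0 ≤ wOz a b c) (hOO : ∀ a b c, 0 ≤ wOO a b c)
    (hcert : ∀ a b c o : ℕ, a + b + c + o = #V → 2 ≤ a + b → 2 ≤ a + c →
      sepE wJ wX wOx wOz wOO a b c o = Mtype a b c o) :
    0 ≤ (Rt 3 F G).coeff (ind V) := by
  -- members inside V have at least two points
  have hbigF : ∀ S, S ⊆ V → S ∈ F → 2 ≤ #S := fun S hSV hS => by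
    by_contra h
    have h' : #S = 0 ∨ #S = 1 := by omega
    rcases h' with h0 | h1
    · exact h0F (card_eq_zero.1 h0 ▸ hS)
    · obtain ⟨x, hx⟩ := card_eq_one.1 h1
      subst hx
      exact h1F x (hSV (mem_singleton_self x)) hS
  have hbigG : ∀ S, S ⊆ V → S ∈ G → 2 ≤ #S := fun S hSV hS => by
    by_contra h
    have h' : #S = 0 ∨ #S = 1 := by omega
    rcases h' with h0 | h1
    · exact h0G (card_eq_zero.1 h0 ▸ hS)
    · obtain ⟨x, hx⟩ := card_eq_one.1 h1
      subst hx
      exact h1G x (hSV (mem_singleton_self x)) hS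
  -- the bilinear form, in ℚ, equals the weighted atom sum
  have hcast : (((Rt 3 F G).coeff (ind V) : ℤ) : ℚ) = atomSum wJ wX wOx wOz wOO F G V := by
    rw [coeff_ind_Rt_three_eq_bilinear, atomSum_eq_sum_sepE]
    push_cast
    refine sum_congr rfl fun S hS => sum_congr rfl fun S' hS' => ?_
    rw [ι_cast, ι_cast, Mrow_eq_Mtype]
    by_cases hSF : S ∈ F
    · by_cases hSG : S' ∈ G
      · have hSV := mem_powerset.1 hS
        have hS'V := mem_powerset.1 hS'
        have h2S := hbigF S hSV hSF
        have h2S' := hbigG S' hS'V hSG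
        have hab : #(S ∩ S') + #(S \ S') = #S := card_inter_add_card_sdiff S S'
        have hac : #(S ∩ S') + #(S' \ S) = #S' := by rw [inter_comm]; exact card_inter_add_card_sdiff S' S
        have hsum : #(S ∩ S') + #(S \ S') + #(S' \ S) + #(V \ (S ∪ S')) = #V := by
          have h1 : #(S ∪ S') + #(S ∩ S') = #S + #S' := card_union_add_card_inter S S'
          have h2 : #(V \ (S ∪ S')) = #V - #(S ∪ S') := card_sdiff_of_subset (union_subset hSV hS'V)
          have h3 : #(S ∪ S') ≤ #V := card_le_card (union_subset hSV hS'V)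
          omega
        rw [hcert _ _ _ _ hsum (by omega) (by omega)]
      · simp [ιq, hSG]
    · simp [ιq, hSF]
  have h := atomSum_nonneg wJ wX wOx wOz wOO hF hG hJ hX hOx hOz hOO V
  rw [← hcast] at h
  exact_mod_cast h


/-! ### Decidable forms of the two hypotheses -/

/-- A table with nonnegative entries is a nonnegative weight function. [this work] -/
theorem tab_nonneg {l : List ((ℕ × ℕ × ℕ) × ℚ)} (h : ∀ p ∈ l, 0 ≤ p.2) : ∀ a b c, 0 ≤ tab l a b c := by
  intro a b c
  unfold tab
  induction l with
  | nil => simp [List.lookup]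
  | cons p l ih =>
    obtain ⟨key, v⟩ := p
    simp only [List.lookup]
    split
    · simpa using h (key, v) (by simp)
    · exact ih fun q hq => h q (List.mem_cons_of_mem _ hq)

/-- The certificate identities from their bounded (decidable) form. [this work] -/
theorem sepCert_of_fin (k : ℕ) (wJ wX wOx wOz wOO : ℕ → ℕ → ℕ → ℚ)
    (h : ∀ a b c : Fin (k + 1), (a : ℕ) + b + c ≤ k → 2 ≤ (a : ℕ) + b → 2 ≤ (a : ℕ) + c →
      sepE wJ wX wOx wOz wOO a b c (k - ((a : ℕ) + b + c)) = Mtype a b c (k - ((a : ℕ) + b + c))) :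
    ∀ a b c o : ℕ, a + b + c + o = k → 2 ≤ a + b → 2 ≤ a + c → sepE wJ wX wOx wOz wOO a b c o = Mtype a b c o := by
  intro a b c o hk hab hac
  have h' := h ⟨a, by omega⟩ ⟨b, by omega⟩ ⟨c, by omega⟩ (by dsimp only; omega) hab hac
  dsimp only at h'
  rw [show o = k - (a + b + c) by omega]
  exact h'

end Cert

end Summit.CriticalPhenomena.PercolationContinuityZ3.Theorems.SahiCTCForms
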